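import Mathlib
import HarnessLib
import Summits.CriticalPhenomena.PercolationContinuityZ3.Theorems.PercNearOneGluingNoHeavyLowerTailTwoCopyLadderAllGradesSide

/-!
# Rungs of all ladders at real `q ∈ [0,1]`: the q-deformed `κ` and the q-POLARIZATION IDENTITY

Helper file for crux `stmt-CriticalPhenomena-4575` (new-inequality factory `prim-ineq-gen-1`, gen 19); memo
`run/shared/lean/prim/prim-ineq-gen-1/FINDING-26-all-grades-spokes-rails.md` §5 and FINDING-27.  Sequel to `…TwoCopyLadderCubic` (gen 18:
`kappa`, `Bform`, `polarization`) and `…TwoCopyLadderAllGradesSide` (gen 19: q-moves `qpendU/qpendW`, `Aq`, `Orb`).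

For the RUNG pairs `(av, u_iw_i)` the two-copy core of the programme in q-weighted types is the universal form `Bhat q X Y`
(`= P_{av,uw}/q³`; 111 monomials; `Bhat 0 = Bform`; validated against brute force for `r ≤ 3`).  This file proves the ALGEBRA of the
real-`q` rung theorem:
* `kstar q L = κ(L) + q·(s(p²+pm+m²) + (p+m)cs − pmd)` — the q-deformation of `κ` — scales by `1+t` under a terminal rung, vanishes after
  merging, and satisfies `(p+m)·kstar(qpendU ρ L) = ρ(ρ+q)(ρ(p+m) + c + qm)·kstar L + E` with `E` a polynomial with NONNEGATIVE coefficients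
  (`kstar_qpendU`, found by linear programming, checked by `ring`; mirror `kstar_qpendW`); hence `kstar ≥ 0` along the orbit
  (`kstar_nonneg_of_orbK`) — LEMMA K_q, valid for every `q ≥ 0`;
* the q-POLARIZATION IDENTITY (`qpolarization`, by `ring`): with `α = p+m`, `β_q = c+p+m+q(d+s)`, `Qsym q X = Bhat q X X` (the symmetric
  double) and an explicit `Gq`,
  `2 β_q(X) β_q(Y) α(X) α(Y) · Bhat q X Y = 2 β_q(X)² β_q(Y)² (pM − mP)² + α(Y)² β_q(Y)² · Qsym q X + α(X)² β_q(X)² · Qsym q Y + q(1−q)·(Gq q X Y)²`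
  (at `q = 0` this is `polarization` of gen 18 since `Qsym 0 X = 2(c+p+m)κ`; the gen-18-shaped weights `β = c+p+m` FAIL for `q > 0` —
  the deformation `β ↦ β + q(d+s)` is forced);
* hence `Bhat q X Y ≥ 0` for `0 ≤ q ≤ 1` as soon as the two SYMMETRIC DOUBLES are nonnegative (`Bhat_nonneg_of_Qsym`): the real-`q` rung theorem
  (Rayleigh negative correlation of the apex edge with every rung of every ladder at every `q ∈ (0,1)`) is reduced to LEMMA Q
  `Qsym q X ≥ 0` on the orbit, which is OPEN (no violation in 21,000 exact samples; not derivable from `kstar, Aq, Dl` by linear certificates).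
NOT formalised: the identification with the graph polynomials (memo §1).  (This work, 2026-08-21.)
-/

namespace Summit.CriticalPhenomena.PercolationContinuityZ3.Theorems

namespace TwoCopyLadderAllGrades

open TwoCopyLadderCubic

variable {R : Type*} [CommRing R]

/-! ## The q-deformed `κ` (LEMMA K_q) -/

/-- `κ*_q = κ + q·(s(p²+pm+m²) + (p+m)cs − pmd)`, the q-deformation of the symmetric-double side form `κ` of gen 18. [this work] -/
def kstar (q : R) (L : SVec R) : R :=
  kappa L + q * (L.s * (L.p ^ 2 + L.p * L.m + L.m ^ 2) + (L.p + L.m) * L.c * L.s - L.p * L.m * L.d)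

/-- `κ*_0 = κ`. [this work] -/
theorem kstar_zero (L : SVec R) : kstar 0 L = kappa L := by
  unfold kstar; ring

/-- `κ*` scales by `1 + t` under a terminal rung. [this work] -/
theorem kstar_rungStep (q t : R) (L : SVec R) : kstar q (rungStep t L) = (1 + t) * kstar q L := by
  unfold kstar kappa rungStep; ring

/-- `κ*` vanishes after merging the terminals. [this work] -/
theorem kstar_mergeUW (q : R) (L : SVec R) : kstar q (mergeUW L) = 0 := by
  unfold kstar kappa mergeUW; ring

/-- `κ*` of the one-vertex side is `0`. [this work] -/
theorem kstar_triv (q : R) : kstar q (triv : SVec R) = 0 := by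
  unfold kstar kappa triv; ring

/-- The nonnegative remainder in `kstar_qpendU` (57 monomials). [this work] -/
def EkU (q ρ : R) (X : SVec R) : R :=
  q ^ 2 * ρ ^ 2 * X.m ^ 3 * X.s + 2 * q ^ 2 * ρ ^ 2 * X.p * X.m ^ 2 * X.s + q ^ 2 * ρ ^ 2 * X.p * X.m ^ 2 * X.d
    + 2 * q ^ 3 * ρ * X.m ^ 3 * X.s + 3 * q ^ 3 * ρ * X.p * X.m ^ 2 * X.s + q ^ 3 * ρ * X.p * X.m ^ 2 * X.d
    + q ^ 4 * X.m ^ 3 * X.s + q ^ 4 * X.p * X.m ^ 2 * X.s + q * ρ ^ 2 * X.m ^ 3 * X.d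
    + q * ρ ^ 2 * X.p * X.m ^ 2 * X.d + q * ρ ^ 2 * X.p * X.m ^ 3 + 2 * q * ρ ^ 2 * X.p ^ 2 * X.m ^ 2
    + 2 * q * ρ ^ 2 * X.p ^ 3 * X.m + q * ρ ^ 2 * X.p ^ 4 + q * ρ ^ 2 * X.c * X.m ^ 2 * X.s
    + q * ρ ^ 2 * X.c * X.m ^ 2 * X.d + 2 * q * ρ ^ 2 * X.c * X.p * X.m * X.s
    + 2 * q * ρ ^ 2 * X.c * X.p * X.m * X.d + 2 * q * ρ ^ 2 * X.c * X.p ^ 2 * X.m + q * ρ ^ 2 * X.c * X.p ^ 3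
    + 2 * q ^ 2 * ρ * X.m ^ 3 * X.d + 2 * q ^ 2 * ρ * X.p * X.m ^ 2 * X.d + 2 * q ^ 2 * ρ * X.p * X.m ^ 3
    + 3 * q ^ 2 * ρ * X.p ^ 2 * X.m ^ 2 + q ^ 2 * ρ * X.p ^ 3 * X.m + 3 * q ^ 2 * ρ * X.c * X.m ^ 2 * X.s
    + q ^ 2 * ρ * X.c * X.m ^ 2 * X.d + 4 * q ^ 2 * ρ * X.c * X.p * X.m * X.s
    + 2 * q ^ 2 * ρ * X.c * X.p * X.m * X.d + q ^ 2 * ρ * X.c * X.p ^ 2 * X.m + q ^ 3 * X.m ^ 3 * X.d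
    + q ^ 3 * X.p * X.m ^ 2 * X.d + q ^ 3 * X.p * X.m ^ 3 + q ^ 3 * X.p ^ 2 * X.m ^ 2
    + 2 * q ^ 3 * X.c * X.m ^ 2 * X.s + 2 * q ^ 3 * X.c * X.p * X.m * X.s + ρ ^ 2 * X.c ^ 2 * X.p ^ 2
    + 2 * q * ρ * X.c * X.m ^ 2 * X.d + 2 * q * ρ * X.c * X.p * X.m * X.d + 2 * q * ρ * X.c * X.p * X.m ^ 2
    + 3 * q * ρ * X.c * X.p ^ 2 * X.m + q * ρ * X.c * X.p ^ 3 + q * ρ * X.c ^ 2 * X.m * X.s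
    + q * ρ * X.c ^ 2 * X.m * X.d + q * ρ * X.c ^ 2 * X.p * X.s + q * ρ * X.c ^ 2 * X.p * X.d
    + q * ρ * X.c ^ 2 * X.p ^ 2 + 2 * q ^ 2 * X.c * X.m ^ 2 * X.d + 2 * q ^ 2 * X.c * X.p * X.m * X.d
    + 2 * q ^ 2 * X.c * X.p * X.m ^ 2 + 2 * q ^ 2 * X.c * X.p ^ 2 * X.m + q ^ 2 * X.c ^ 2 * X.m * X.s
    + q ^ 2 * X.c ^ 2 * X.p * X.s + q * X.c ^ 2 * X.m * X.d + q * X.c ^ 2 * X.p * X.d + q * X.c ^ 2 * X.p * X.m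
    + q * X.c ^ 2 * X.p ^ 2

/-- LEMMA K_q, pendant edge at `u`: `(p+m)·κ*(qpendU ρ X) = ρ(ρ+q)(ρ(p+m) + c + qm)·κ*(X) + EkU` (multiplier found by LP). [this work] -/
theorem kstar_qpendU (q ρ : R) (X : SVec R) :
    (X.p + X.m) * kstar q (qpendU q ρ X) = ρ * (ρ + q) * (ρ * (X.p + X.m) + X.c + q * X.m) * kstar q X + EkU q ρ X := by
  unfold kstar kappa qpendU EkU; ring

/-- The nonnegative remainder in `kstar_qpendW` (mirror of `EkU`). [this work] -/
def EkW (q ρ : R) (X : SVec R) : R :=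
  2 * q ^ 2 * ρ ^ 2 * X.p ^ 2 * X.m * X.s + q ^ 2 * ρ ^ 2 * X.p ^ 2 * X.m * X.d + q ^ 2 * ρ ^ 2 * X.p ^ 3 * X.s
    + 3 * q ^ 3 * ρ * X.p ^ 2 * X.m * X.s + q ^ 3 * ρ * X.p ^ 2 * X.m * X.d + 2 * q ^ 3 * ρ * X.p ^ 3 * X.s
    + q ^ 4 * X.p ^ 2 * X.m * X.s + q ^ 4 * X.p ^ 3 * X.s + q * ρ ^ 2 * X.m ^ 4 + 2 * q * ρ ^ 2 * X.p * X.m ^ 3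
    + q * ρ ^ 2 * X.p ^ 2 * X.m * X.d + 2 * q * ρ ^ 2 * X.p ^ 2 * X.m ^ 2 + q * ρ ^ 2 * X.p ^ 3 * X.d
    + q * ρ ^ 2 * X.p ^ 3 * X.m + q * ρ ^ 2 * X.c * X.m ^ 3 + 2 * q * ρ ^ 2 * X.c * X.p * X.m * X.s
    + 2 * q * ρ ^ 2 * X.c * X.p * X.m * X.d + 2 * q * ρ ^ 2 * X.c * X.p * X.m ^ 2 + q * ρ ^ 2 * X.c * X.p ^ 2 * X.s
    + q * ρ ^ 2 * X.c * X.p ^ 2 * X.d + q ^ 2 * ρ * X.p * X.m ^ 3 + 2 * q ^ 2 * ρ * X.p ^ 2 * X.m * X.d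
    + 3 * q ^ 2 * ρ * X.p ^ 2 * X.m ^ 2 + 2 * q ^ 2 * ρ * X.p ^ 3 * X.d + 2 * q ^ 2 * ρ * X.p ^ 3 * X.m
    + 4 * q ^ 2 * ρ * X.c * X.p * X.m * X.s + 2 * q ^ 2 * ρ * X.c * X.p * X.m * X.d
    + q ^ 2 * ρ * X.c * X.p * X.m ^ 2 + 3 * q ^ 2 * ρ * X.c * X.p ^ 2 * X.s + q ^ 2 * ρ * X.c * X.p ^ 2 * X.d
    + q ^ 3 * X.p ^ 2 * X.m * X.d + q ^ 3 * X.p ^ 2 * X.m ^ 2 + q ^ 3 * X.p ^ 3 * X.d + q ^ 3 * X.p ^ 3 * X.m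
    + 2 * q ^ 3 * X.c * X.p * X.m * X.s + 2 * q ^ 3 * X.c * X.p ^ 2 * X.s + ρ ^ 2 * X.c ^ 2 * X.m ^ 2
    + q * ρ * X.c * X.m ^ 3 + 2 * q * ρ * X.c * X.p * X.m * X.d + 3 * q * ρ * X.c * X.p * X.m ^ 2
    + 2 * q * ρ * X.c * X.p ^ 2 * X.d + 2 * q * ρ * X.c * X.p ^ 2 * X.m + q * ρ * X.c ^ 2 * X.m * X.s
    + q * ρ * X.c ^ 2 * X.m * X.d + q * ρ * X.c ^ 2 * X.m ^ 2 + q * ρ * X.c ^ 2 * X.p * X.s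
    + q * ρ * X.c ^ 2 * X.p * X.d + 2 * q ^ 2 * X.c * X.p * X.m * X.d + 2 * q ^ 2 * X.c * X.p * X.m ^ 2
    + 2 * q ^ 2 * X.c * X.p ^ 2 * X.d + 2 * q ^ 2 * X.c * X.p ^ 2 * X.m + q ^ 2 * X.c ^ 2 * X.m * X.s
    + q ^ 2 * X.c ^ 2 * X.p * X.s + q * X.c ^ 2 * X.m * X.d + q * X.c ^ 2 * X.m ^ 2 + q * X.c ^ 2 * X.p * X.d
    + q * X.c ^ 2 * X.p * X.m

/-- LEMMA K_q, pendant edge at `w` (mirror image). [this work] -/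
theorem kstar_qpendW (q ρ : R) (X : SVec R) :
    (X.p + X.m) * kstar q (qpendW q ρ X) = ρ * (ρ + q) * (ρ * (X.p + X.m) + X.c + q * X.p) * kstar q X + EkW q ρ X := by
  unfold kstar kappa qpendW EkW; ring

/-! ## The q-rung form and the q-polarization identity -/

/-- Mirror side form `Ã_q` (`Aq` with `p ↔ m`). [this work] -/
def Atq (q : R) (L : SVec R) : R :=
  L.m * (L.c + L.p + L.m + L.d) + q * L.m * L.s + (1 - q) * (L.p * L.d - L.c * L.s)

/-- The universal all-`q` RUNG form `P_{av,uw}/q³` in the q-weighted types of the two sides (structured form, memo FINDING-27 §1):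
`(β+qs)(m·A_q(Y) + p·Ã_q(Y)) + (Β + q(D+S))·d·(pM + mP + (1−q)(pP + mM)) − (1−q)·cs·Β·(P+M+qS)`. [this work] -/
def Bhat (q : R) (X Y : SVec R) : R :=
  (X.c + X.p + X.m + q * X.s) * (X.m * Aq q Y + X.p * Atq q Y)
    + (Y.c + Y.p + Y.m + q * (Y.d + Y.s)) * X.d * (X.p * Y.m + X.m * Y.p + (1 - q) * (X.p * Y.p + X.m * Y.m))
    - (1 - q) * X.c * X.s * (Y.c + Y.p + Y.m) * (Y.p + Y.m + q * Y.s)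

/-- At `q = 0` the rung form is `Bform` of gen 18. [this work] -/
theorem Bhat_zero (X Y : SVec R) : Bhat 0 X Y = Bform X Y := by
  unfold Bhat Bform Aq Atq; ring

/-- The rung form is symmetric in the two sides. [this work] -/
theorem Bhat_symm (q : R) (X Y : SVec R) : Bhat q X Y = Bhat q Y X := by
  unfold Bhat Aq Atq; ring

/-- A terminal rung on one side scales the rung form by `1 + t`. [this work] -/
theorem Bhat_rungStep (q t : R) (X Y : SVec R) : Bhat q (rungStep t X) Y = (1 + t) * Bhat q X Y := by
  unfold Bhat Aq Atq rungStep; ring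

/-- The rung form vanishes after merging the terminals of one side (`f` becomes a loop). [this work] -/
theorem Bhat_mergeUW (q : R) (X Y : SVec R) : Bhat q (mergeUW X) Y = 0 := by
  unfold Bhat Aq Atq mergeUW; ring

/-- The symmetric-double form `Q_q(X) = Bhat q X X` (quartic; `= P/q³` of the symmetric double `G₁ ⊕_{u,w} G₁'`). [this work] -/
def Qsym (q : R) (X : SVec R) : R := Bhat q X X

/-- `Q_0 = 2(c+p+m)·κ`. [this work] -/
theorem Qsym_zero (X : SVec R) : Qsym 0 X = 2 * (X.c + X.p + X.m) * kappa X := by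
  unfold Qsym Bhat Aq Atq kappa; ring

/-- The polynomial whose square carries the `q(1−q)` correction in the q-polarization identity:
`G_q = αβ(ΑD − CS) − ΑΒ(αd − cs) + q[αΑ(sD − dS) + csΑ(D+S) − CSα(d+s)]`. [this work] -/
def Gq (q : R) (X Y : SVec R) : R :=
  (X.p + X.m) * (X.c + X.p + X.m) * ((Y.p + Y.m) * Y.d - Y.c * Y.s)
    - (Y.p + Y.m) * (Y.c + Y.p + Y.m) * ((X.p + X.m) * X.d - X.c * X.s)
    + q * ((X.p + X.m) * (Y.p + Y.m) * (X.s * Y.d - X.d * Y.s) + X.c * X.s * (Y.p + Y.m) * (Y.d + Y.s)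
        - Y.c * Y.s * (X.p + X.m) * (X.d + X.s))

/-- THE q-POLARIZATION IDENTITY (exact; at `q = 0` it is `polarization` of gen 18). [this work] -/
theorem qpolarization (q : R) (X Y : SVec R) :
    2 * (X.c + X.p + X.m + q * (X.d + X.s)) * (Y.c + Y.p + Y.m + q * (Y.d + Y.s)) * (X.p + X.m) * (Y.p + Y.m) * Bhat q X Y
      = 2 * (X.c + X.p + X.m + q * (X.d + X.s)) ^ 2 * (Y.c + Y.p + Y.m + q * (Y.d + Y.s)) ^ 2 * (X.p * Y.m - X.m * Y.p) ^ 2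
        + (Y.p + Y.m) ^ 2 * (Y.c + Y.p + Y.m + q * (Y.d + Y.s)) ^ 2 * Qsym q X
        + (X.p + X.m) ^ 2 * (X.c + X.p + X.m + q * (X.d + X.s)) ^ 2 * Qsym q Y
        + q * (1 - q) * Gq q X Y ^ 2 := by
  unfold Qsym Bhat Aq Atq Gq; ring

/-! ## Consequences in an ordered ring -/

section Ordered

variable {S : Type*} [CommRing S] [LinearOrder S] [IsStrictOrderedRing S]

/-- THE REDUCTION: for `0 ≤ q ≤ 1`, nonnegative entries, `p + m > 0` on both sides and nonnegative symmetric doubles, the rung form is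
nonnegative — the real-`q` rung theorem modulo LEMMA Q. [this work] -/
theorem Bhat_nonneg_of_Qsym {q : S} (hq0 : 0 ≤ q) (hq1 : q ≤ 1) {X Y : SVec S} (hX : X.Nonneg) (hY : Y.Nonneg)
    (hαX : 0 < X.p + X.m) (hαY : 0 < Y.p + Y.m) (hQX : 0 ≤ Qsym q X) (hQY : 0 ≤ Qsym q Y) : 0 ≤ Bhat q X Y := by
  obtain ⟨hc, hp, hm, hd, hs⟩ := hX
  obtain ⟨hC, hP, hM, hD, hS⟩ := hY
  have hβX : 0 < X.c + X.p + X.m + q * (X.d + X.s) := by nlinarith [mul_nonneg hq0 (add_nonneg hd hs)]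
  have hβY : 0 < Y.c + Y.p + Y.m + q * (Y.d + Y.s) := by nlinarith [mul_nonneg hq0 (add_nonneg hD hS)]
  have key := qpolarization q X Y
  have h1q : 0 ≤ 1 - q := by linarith
  have hrhs : 0 ≤ 2 * (X.c + X.p + X.m + q * (X.d + X.s)) * (Y.c + Y.p + Y.m + q * (Y.d + Y.s)) * (X.p + X.m) * (Y.p + Y.m)
      * Bhat q X Y := by
    rw [key]
    have e1 : 0 ≤ 2 * (X.c + X.p + X.m + q * (X.d + X.s)) ^ 2 * (Y.c + Y.p + Y.m + q * (Y.d + Y.s)) ^ 2 * (X.p * Y.m - X.m * Y.p) ^ 2 := by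
      positivity
    have e2 : 0 ≤ (Y.p + Y.m) ^ 2 * (Y.c + Y.p + Y.m + q * (Y.d + Y.s)) ^ 2 * Qsym q X :=
      mul_nonneg (mul_nonneg (sq_nonneg _) (sq_nonneg _)) hQX
    have e3 : 0 ≤ (X.p + X.m) ^ 2 * (X.c + X.p + X.m + q * (X.d + X.s)) ^ 2 * Qsym q Y :=
      mul_nonneg (mul_nonneg (sq_nonneg _) (sq_nonneg _)) hQY
    have e4 : 0 ≤ q * (1 - q) * Gq q X Y ^ 2 := mul_nonneg (mul_nonneg hq0 h1q) (sq_nonneg _)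
    linarith
  have hpos : 0 < 2 * (X.c + X.p + X.m + q * (X.d + X.s)) * (Y.c + Y.p + Y.m + q * (Y.d + Y.s)) * (X.p + X.m) * (Y.p + Y.m) :=
    mul_pos (mul_pos (mul_pos (mul_pos two_pos hβX) hβY) hαX) hαY
  exact (mul_nonneg_iff_of_pos_left hpos).mp hrhs

/-- The invariant for LEMMA K_q along the orbit: nonnegative entries, `κ* ≥ 0`, and the degeneracy clause `p + m = 0 → c = 0 ∨ s = 0`
(as in the GOOD class of gen 18). [this work] -/
structure GoodK (q : S) (X : SVec S) : Prop where
  /-- entries nonnegative -/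
  hN : X.Nonneg
  /-- `κ* ≥ 0` -/
  hk : 0 ≤ kstar q X
  /-- degeneracy clause -/
  hdeg : X.p + X.m = 0 → X.c = 0 ∨ X.s = 0

/-- `triv` is good. [this work] -/
theorem goodK_triv (q : S) : GoodK q (triv : SVec S) := by
  refine ⟨⟨zero_le_one, le_rfl, le_rfl, le_rfl, le_rfl⟩, (kstar_triv q).symm.le, fun _ => Or.inr rfl⟩

/-- A terminal rung preserves the invariant. [this work] -/
theorem goodK_rungStep {q t : S} (ht : 0 ≤ t) {X : SVec S} (h : GoodK q X) : GoodK q (rungStep t X) := by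
  obtain ⟨⟨hc, hp, hm, hd, hs⟩, hk, hdeg⟩ := h
  refine ⟨⟨?_, hp, hm, ?_, hs⟩, ?_, ?_⟩
  · show 0 ≤ X.c + t * (X.c + X.p + X.m); positivity
  · show 0 ≤ X.d + t * (X.d + X.s); positivity
  · rw [kstar_rungStep]; exact mul_nonneg (by linarith) hk
  · intro h0
    rcases hdeg h0 with h1 | h1
    · left; show X.c + t * (X.c + X.p + X.m) = 0
      have : X.p + X.m = 0 := h0
      rw [h1]; linear_combination t * this
    · right; exact h1

/-- Merging preserves the invariant. [this work] -/
theorem goodK_mergeUW {q : S} {X : SVec S} (h : GoodK q X) : GoodK q (mergeUW X) := by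
  obtain ⟨⟨hc, hp, hm, hd, hs⟩, _, _⟩ := h
  refine ⟨⟨?_, le_rfl, le_rfl, ?_, le_rfl⟩, (kstar_mergeUW q X).symm.le, fun _ => Or.inr rfl⟩
  · show 0 ≤ X.c + X.p + X.m; positivity
  · show 0 ≤ X.d + X.s; positivity

/-- A pendant edge at `u` preserves the invariant (`0 ≤ q`, `0 ≤ ρ`). [this work] -/
theorem goodK_qpendU {q ρ : S} (hq : 0 ≤ q) (hρ : 0 ≤ ρ) {X : SVec S} (h : GoodK q X) : GoodK q (qpendU q ρ X) := by
  obtain ⟨⟨hc, hp, hm, hd, hs⟩, hk, hdeg⟩ := h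
  have hN' : (qpendU q ρ X).Nonneg := by
    refine ⟨?_, ?_, ?_, ?_, ?_⟩ <;> simp only [qpendU] <;> positivity
  refine ⟨hN', ?_, ?_⟩
  · rcases lt_or_eq_of_le (add_nonneg hp hm : (0:S) ≤ X.p + X.m) with hpos | h0
    · have key := kstar_qpendU q ρ X
      have hE : 0 ≤ EkU q ρ X := by unfold EkU; positivity
      have hrhs : 0 ≤ (X.p + X.m) * kstar q (qpendU q ρ X) := by
        rw [key]
        have : 0 ≤ ρ * (ρ + q) * (ρ * (X.p + X.m) + X.c + q * X.m) * kstar q X := by positivity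
        linarith
      exact (mul_nonneg_iff_of_pos_left hpos).mp hrhs
    · have hp0 : X.p = 0 := by linarith
      have hm0 : X.m = 0 := by linarith
      rcases hdeg h0.symm with hc0 | hs0
      · have e : kstar q (qpendU q ρ X) = 0 := by
          unfold kstar kappa qpendU; rw [hp0, hm0, hc0]; ring
        rw [e]
      · have e : kstar q (qpendU q ρ X) = X.c ^ 2 * (q * X.d * (1 + ρ)) := by
          unfold kstar kappa qpendU; rw [hp0, hm0, hs0]; ring
        rw [e]; positivity
  · intro h0
    have h0' : ρ * X.p + (ρ * X.m + q * X.m + X.c) = 0 := h0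
    have hc0 : X.c = 0 := by nlinarith [mul_nonneg hρ hp, mul_nonneg hρ hm, mul_nonneg hq hm]
    left; show ρ * X.c = 0; rw [hc0]; ring

/-- A pendant edge at `w` preserves the invariant. [this work] -/
theorem goodK_qpendW {q ρ : S} (hq : 0 ≤ q) (hρ : 0 ≤ ρ) {X : SVec S} (h : GoodK q X) : GoodK q (qpendW q ρ X) := by
  obtain ⟨⟨hc, hp, hm, hd, hs⟩, hk, hdeg⟩ := h
  have hN' : (qpendW q ρ X).Nonneg := by
    refine ⟨?_, ?_, ?_, ?_, ?_⟩ <;> simp only [qpendW] <;> positivity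
  refine ⟨hN', ?_, ?_⟩
  · rcases lt_or_eq_of_le (add_nonneg hp hm : (0:S) ≤ X.p + X.m) with hpos | h0
    · have key := kstar_qpendW q ρ X
      have hE : 0 ≤ EkW q ρ X := by unfold EkW; positivity
      have hrhs : 0 ≤ (X.p + X.m) * kstar q (qpendW q ρ X) := by
        rw [key]
        have : 0 ≤ ρ * (ρ + q) * (ρ * (X.p + X.m) + X.c + q * X.p) * kstar q X := by positivity
        linarith
      exact (mul_nonneg_iff_of_pos_left hpos).mp hrhs
    · have hp0 : X.p = 0 := by linarith
      have hm0 : X.m = 0 := by linarith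
      rcases hdeg h0.symm with hc0 | hs0
      · have e : kstar q (qpendW q ρ X) = 0 := by
          unfold kstar kappa qpendW; rw [hp0, hm0, hc0]; ring
        rw [e]
      · have e : kstar q (qpendW q ρ X) = X.c ^ 2 * (q * X.d * (1 + ρ)) := by
          unfold kstar kappa qpendW; rw [hp0, hm0, hs0]; ring
        rw [e]; positivity
  · intro h0
    have h0' : (ρ * X.p + q * X.p + X.c) + ρ * X.m = 0 := h0
    have hc0 : X.c = 0 := by nlinarith [mul_nonneg hρ hp, mul_nonneg hρ hm, mul_nonneg hq hp]
    left; show ρ * X.c = 0; rw [hc0]; ring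

/-- LEMMA K_q: `κ* ≥ 0` (indeed the whole invariant) along the orbit of the q-moves, for `q ≥ 0`. [this work] -/
theorem goodK_of_orb {q : S} (hq : 0 ≤ q) {X : SVec S} (hX : Orb (fun x : S => 0 ≤ x) q X) : GoodK q X := by
  induction hX with
  | triv => exact goodK_triv q
  | rung ht _ ih => exact goodK_rungStep ht ih
  | pendU hρ _ ih => exact goodK_qpendU hq hρ ih
  | pendW hρ _ ih => exact goodK_qpendW hq hρ ih
  | merge _ ih => exact goodK_mergeUW ih

/-- LEMMA K_q for ladder sides: `κ*_q ≥ 0` on every q-type vector of a ladder side with a terminal rung, every `q ≥ 0`. [this work] -/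
theorem kstar_ladder_nonneg {q t y₁ y₂ : S} (hq : 0 ≤ q) (ht : 0 ≤ t) (hy₁ : 0 ≤ y₁) (hy₂ : 0 ≤ y₂) (cols : List (S × S × S))
    (h : ∀ trr ∈ cols, 0 ≤ trr.1 ∧ 0 ≤ trr.2.1 ∧ 0 ≤ trr.2.2) : 0 ≤ kstar q (rungStep t (qseg q y₁ y₂ cols)) :=
  (goodK_of_orb hq (Orb.rung ht (orb_qseg (P := fun x : S => 0 ≤ x) hy₁ hy₂ cols h))).hk


/-- On a ladder side with positive spoke weights, `p + m` stays positive (all `q ≥ 0`, nonnegative column weights, any terminal rung). [this work] -/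
theorem qseg_pm_pos {q y₁ y₂ : S} (hq : 0 ≤ q) (hy₁ : 0 < y₁) (hy₂ : 0 < y₂) :
    ∀ (cols : List (S × S × S)), (∀ trr ∈ cols, 0 ≤ trr.1 ∧ 0 < trr.2.1 ∧ 0 < trr.2.2) → ∀ t : S,
      0 < (rungStep t (qseg q y₁ y₂ cols)).p + (rungStep t (qseg q y₁ y₂ cols)).m
  | [], _, t => by
      show 0 < (base y₁ y₂).p + (base y₁ y₂).m
      simp only [base]; positivity
  | (tt, r₁, r₂) :: cols, h, t => by
      have hcols : ∀ trr ∈ cols, 0 ≤ trr.1 ∧ 0 < trr.2.1 ∧ 0 < trr.2.2 := fun trr htrr => h trr (List.mem_cons_of_mem _ htrr)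
      have hcols' : ∀ trr ∈ cols, 0 ≤ trr.1 ∧ 0 ≤ trr.2.1 ∧ 0 ≤ trr.2.2 :=
        fun trr htrr => ⟨(hcols trr htrr).1, (hcols trr htrr).2.1.le, (hcols trr htrr).2.2.le⟩
      obtain ⟨htt, h1, h2⟩ := h (tt, r₁, r₂) List.mem_cons_self
      have ih := qseg_pm_pos hq hy₁ hy₂ cols hcols tt
      have gX := goodK_of_orb hq (Orb.rung htt (orb_qseg (P := fun x : S => 0 ≤ x) hy₁.le hy₂.le cols hcols'))
      obtain ⟨hc, hp, hm, hd, hs⟩ := gX.hN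
      show 0 < (qpendU q r₁ (qpendW q r₂ (rungStep tt (qseg q y₁ y₂ cols)))).p
        + (qpendU q r₁ (qpendW q r₂ (rungStep tt (qseg q y₁ y₂ cols)))).m
      simp only [qpendU, qpendW]
      set Z := rungStep tt (qseg q y₁ y₂ cols) with hZ
      have hZp : 0 ≤ Z.p := hp
      have hZm : 0 ≤ Z.m := hm
      have hZc : 0 ≤ Z.c := hc
      have hpm : 0 < Z.p + Z.m := ih
      nlinarith [mul_nonneg h1.le hZc, mul_nonneg h2.le hZc, mul_nonneg hq hZp, mul_nonneg hq hZm, mul_pos (mul_pos h1 h2) hpm,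
        mul_nonneg h1.le (mul_nonneg hq hZp), mul_nonneg h2.le (mul_nonneg hq hZm)]

/-- THE REAL-q RUNG THEOREM MODULO LEMMA Q (algebraic form): for `0 ≤ q ≤ 1` and two ladder sides (positive spokes, nonnegative column
weights, terminal rungs `t, t'`) whose symmetric doubles are nonnegative, the all-`q` rung form `P_{L_r+av; av, u_iw_i}/q³` is nonnegative —
Rayleigh negative correlation of the apex edge with the rung at this `q`.  LEMMA Q (`0 ≤ Qsym`) is census-true and open. [this work] -/
theorem rung_allq_nonneg_of_Qsym {q t t' y₁ y₂ z₁ z₂ : S} (hq0 : 0 ≤ q) (hq1 : q ≤ 1) (ht : 0 ≤ t) (ht' : 0 ≤ t')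
    (hy₁ : 0 < y₁) (hy₂ : 0 < y₂) (hz₁ : 0 < z₁) (hz₂ : 0 < z₂) (cols cols' : List (S × S × S))
    (h : ∀ trr ∈ cols, 0 ≤ trr.1 ∧ 0 < trr.2.1 ∧ 0 < trr.2.2) (h' : ∀ trr ∈ cols', 0 ≤ trr.1 ∧ 0 < trr.2.1 ∧ 0 < trr.2.2)
    (hQX : 0 ≤ Qsym q (rungStep t (qseg q y₁ y₂ cols))) (hQY : 0 ≤ Qsym q (rungStep t' (qseg q z₁ z₂ cols'))) :
    0 ≤ Bhat q (rungStep t (qseg q y₁ y₂ cols)) (rungStep t' (qseg q z₁ z₂ cols')) := by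
  have hw : ∀ trr ∈ cols, 0 ≤ trr.1 ∧ 0 ≤ trr.2.1 ∧ 0 ≤ trr.2.2 := fun trr htrr => ⟨(h trr htrr).1, (h trr htrr).2.1.le, (h trr htrr).2.2.le⟩
  have hw' : ∀ trr ∈ cols', 0 ≤ trr.1 ∧ 0 ≤ trr.2.1 ∧ 0 ≤ trr.2.2 :=
    fun trr htrr => ⟨(h' trr htrr).1, (h' trr htrr).2.1.le, (h' trr htrr).2.2.le⟩
  have gX := goodK_of_orb hq0 (Orb.rung ht (orb_qseg (P := fun x : S => 0 ≤ x) hy₁.le hy₂.le cols hw))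
  have gY := goodK_of_orb hq0 (Orb.rung ht' (orb_qseg (P := fun x : S => 0 ≤ x) hz₁.le hz₂.le cols' hw'))
  exact Bhat_nonneg_of_Qsym hq0 hq1 gX.hN gY.hN (qseg_pm_pos hq0 hy₁ hy₂ cols h t) (qseg_pm_pos hq0 hz₁ hz₂ cols' h' t') hQX hQY

end Ordered

end TwoCopyLadderAllGrades

end Summit.CriticalPhenomena.PercolationContinuityZ3.Theorems
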